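import Mathlib
import Summits.KontsevichZagierPeriods.Zeta5Search.StaircaseCells
import Summits.KontsevichZagierPeriods.Zeta5Search.ClassTypeGuards
import Summits.KontsevichZagierPeriods.Zeta5Search.CellKitAffine
import HarnessLib

/-!
# ζ(5) search — STAIRCASE cells, TOP linear family I: ray facts and net-exponent regions of `bTop s n` (DENOM-LAW D1, prover-d1)

HONEST FRAMING: systematic search; no irrationality claim unless certified.  Cell `pub-zeta5`, track «DENOM-LAW» D1 (the staircase
theorem), seat `denom-prover-d1`.  Part I of the proof that the staircase cell of the TOP linear family
`bTop s n = n·(3s+16; s+8, …, s+2) = bLin ((s+2)n) (sn) n` (`StaircaseCells.bTop`; `s = 6`: TOP_STAIR #1 `(7,13,9,12,11,15,17,12)`,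
`s = 7`: TOP_STAIR #9) is a theorem for all `n`: the ray facts (`b₀`, `d`, polytope membership, identification with `bOfA` of the two
census directions), the sixteen NET-EXPONENT REGIONS of the ray as `omega`-checkable level lemmas, and the typed-class constructors.
Part II (`StairTopFamily.lean`) builds the class-type cover of the cell `(s+8)n < p < (s+9)n` and concludes by THEOREM LB.
Valuations of explicit rationals; every model exponent these feed is `< 1` — no irrationality content; records in print UNMOVED.
-/

open Finset

namespace Summit.KontsevichZagierPeriods.Zeta5Search.StairTop

open Summit.KontsevichZagierPeriods.Zeta5Search.ClusterValuation
open Summit.KontsevichZagierPeriods.Zeta5Search.CasoratianValuation (InPolytope shift casoratian)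
open Summit.KontsevichZagierPeriods.Zeta5Search.WedgeDictionary (dOf)
open Summit.KontsevichZagierPeriods.Zeta5Search.CellKit
open Summit.KontsevichZagierPeriods.Zeta5Search.ClassTypeCover
open Summit.KontsevichZagierPeriods.Zeta5Search.StaircaseCells (bTop StairTopFamilyCell StairCellTS1 StairCellTS9)

/-! ## §1 The ray `bTop s n = bLin ((s+2)n) (sn) n` (`StaircaseCells.bTop`) -/

/-- `b₀ = (3s+16)n` as a natural number. -/
theorem bTop_zero_toNat (s n : ℕ) : (bTop s n 0).toNat = 3 * (s * n) + 16 * n := by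
  unfold bTop; rw [bLin_zero_toNat]; ring

/-- `b₀ = (3s+16)n` as an integer. -/
theorem bTop_zero (s n : ℕ) : bTop s n 0 = ((3 * (s * n) + 16 * n : ℕ) : ℤ) := by
  unfold bTop; rw [bLin_zero]; push_cast; ring

/-- `d = 3b₀ − Σ b_j = (2s+13)n`. -/
theorem dOf_bTop (s n : ℕ) : dOf (bTop s n) = ((2 * (s * n) + 13 * n : ℕ) : ℤ) := by
  unfold bTop; rw [dOf_bLin]; push_cast; ring

/-- The ray lies in the Brown–Zudilin polytope. -/
theorem inPolytope_bTop (s n : ℕ) : InPolytope (bTop s n) := by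
  unfold bTop; exact inPolytope_bLin (by omega)

/-- Its `e₇`-shift lies in the polytope (`n ≥ 1`). -/
theorem inPolytope_shift_bTop (s : ℕ) {n : ℕ} (hn : 1 ≤ n) : InPolytope (shift (bTop s n) 7) := by
  unfold bTop; exact inPolytope_shift_bLin hn (by omega)

section Rays

open Literature.NumberTheory.Irrationality.BrownZudilin2022 (bOfA)
open Summit.KontsevichZagierPeriods.Zeta5Search.WedgeDictionary (bOfA_nsmul)

/-- `bTop 6 n = b(n·a)` for TOP_STAIR #1 `a = (7,13,9,12,11,15,17,12)`: the dual ray `n·(34; 14,13,12,11,10,9,8)`. -/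
theorem bTop_six_eq_bOfA (n : ℕ) : bOfA (fun i => (n : ℤ) * (![7, 13, 9, 12, 11, 15, 17, 12] : Fin 8 → ℤ) i) = bTop 6 n := by
  funext j
  rw [bOfA_nsmul]
  rcases j with _ | _ | _ | _ | _ | _ | _ | _ | j
  all_goals first
    | (simp [bTop, bLin, bOfA]; ring)
    | simp [bTop, bLin, bOfA]

/-- `bTop 7 n = b(n·a)` for TOP_STAIR #9 `a = (8,14,10,13,12,16,18,13)`: the dual ray `n·(37; 15,14,13,12,11,10,9)`. -/
theorem bTop_seven_eq_bOfA (n : ℕ) : bOfA (fun i => (n : ℤ) * (![8, 14, 10, 13, 12, 16, 18, 13] : Fin 8 → ℤ) i) = bTop 7 n := by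
  funext j
  rw [bOfA_nsmul]
  rcases j with _ | _ | _ | _ | _ | _ | _ | _ | j
  all_goals first
    | (simp [bTop, bLin, bOfA]; ring)
    | simp [bTop, bLin, bOfA]

end Rays

/-! ## §2 Net-exponent regions of the ray (`a = (s+2)n`, `e = sn`: lower staircase `[a+(k−1)n, a+kn)`, well `[a+6n, a+6n+e]`,
upper staircase `(a+(12−k)n+e, a+(13−k)n+e]`, even centre `2q = b₀`) -/

section Levels

variable {s n q : ℕ}

/-- Below the blocks: `q < (s+2)n`. -/
theorem ne_low (h : q < s * n + 2 * n) : netExp (bTop s n) q = 1 := by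
  unfold bTop; rw [netExp_bLin_of_ne (by omega), depL_low h]; norm_num

/-- `[(s+2)n, (s+3)n)`: depth 1. -/
theorem ne_d1 (h : s * n + 2 * n ≤ q ∧ q < s * n + 3 * n) : netExp (bTop s n) q = 0 := by
  unfold bTop
  rw [netExp_bLin_of_ne (by omega), depL_lower (by norm_num : 1 ≤ 1) (by norm_num) (by omega) (by omega)]; norm_num

/-- `[(s+3)n, (s+4)n)`: depth 2. -/
theorem ne_d2 (h : s * n + 3 * n ≤ q ∧ q < s * n + 4 * n) : netExp (bTop s n) q = -1 := by
  unfold bTop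
  rw [netExp_bLin_of_ne (by omega), depL_lower (by norm_num : 1 ≤ 2) (by norm_num) (by omega) (by omega)]; norm_num

/-- `[(s+4)n, (s+5)n)`: depth 3. -/
theorem ne_d3 (h : s * n + 4 * n ≤ q ∧ q < s * n + 5 * n) : netExp (bTop s n) q = -2 := by
  unfold bTop
  rw [netExp_bLin_of_ne (by omega), depL_lower (by norm_num : 1 ≤ 3) (by norm_num) (by omega) (by omega)]; norm_num

/-- `[(s+5)n, (s+6)n)`: depth 4. -/
theorem ne_d4 (h : s * n + 5 * n ≤ q ∧ q < s * n + 6 * n) : netExp (bTop s n) q = -3 := by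
  unfold bTop
  rw [netExp_bLin_of_ne (by omega), depL_lower (by norm_num : 1 ≤ 4) (by norm_num) (by omega) (by omega)]; norm_num

/-- `[(s+6)n, (s+7)n)`: depth 5. -/
theorem ne_d5 (h : s * n + 6 * n ≤ q ∧ q < s * n + 7 * n) : netExp (bTop s n) q = -4 := by
  unfold bTop
  rw [netExp_bLin_of_ne (by omega), depL_lower (by norm_num : 1 ≤ 5) (by norm_num) (by omega) (by omega)]; norm_num

/-- `[(s+7)n, (s+8)n)`: depth 6. -/
theorem ne_d6 (h : s * n + 7 * n ≤ q ∧ q < s * n + 8 * n) : netExp (bTop s n) q = -5 := by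
  unfold bTop
  rw [netExp_bLin_of_ne (by omega), depL_lower (by norm_num : 1 ≤ 6) (by norm_num) (by omega) (by omega)]; norm_num

/-- The well `[(s+8)n, (2s+8)n]` off the centre: depth 7. -/
theorem ne_well (h : s * n + 8 * n ≤ q ∧ q ≤ 2 * (s * n) + 8 * n ∧ 2 * q ≠ 3 * (s * n) + 16 * n) :
    netExp (bTop s n) q = -6 := by
  unfold bTop
  rw [netExp_bLin_of_ne (by omega), depL_well (by omega) (by omega)]; norm_num

/-- The even centre `2q = (3s+16)n` (inside the well). -/
theorem ne_cen (h : 2 * q = 3 * (s * n) + 16 * n) : netExp (bTop s n) q = -5 := by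
  unfold bTop
  rw [netExp_bLin_centre (by omega), depL_well (by omega) (by omega)]; norm_num

/-- `((2s+8)n, (2s+9)n]`: depth 6. -/
theorem ne_u6 (h : 2 * (s * n) + 8 * n < q ∧ q ≤ 2 * (s * n) + 9 * n) : netExp (bTop s n) q = -5 := by
  unfold bTop
  rw [netExp_bLin_of_ne (by omega), depL_upper (by norm_num : 1 ≤ 6) (by norm_num) (by omega) (by omega)]; norm_num

/-- `((2s+9)n, (2s+10)n]`: depth 5. -/
theorem ne_u5 (h : 2 * (s * n) + 9 * n < q ∧ q ≤ 2 * (s * n) + 10 * n) : netExp (bTop s n) q = -4 := by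
  unfold bTop
  rw [netExp_bLin_of_ne (by omega), depL_upper (by norm_num : 1 ≤ 5) (by norm_num) (by omega) (by omega)]; norm_num

/-- `((2s+10)n, (2s+11)n]`: depth 4. -/
theorem ne_u4 (h : 2 * (s * n) + 10 * n < q ∧ q ≤ 2 * (s * n) + 11 * n) : netExp (bTop s n) q = -3 := by
  unfold bTop
  rw [netExp_bLin_of_ne (by omega), depL_upper (by norm_num : 1 ≤ 4) (by norm_num) (by omega) (by omega)]; norm_num

/-- `((2s+11)n, (2s+12)n]`: depth 3. -/
theorem ne_u3 (h : 2 * (s * n) + 11 * n < q ∧ q ≤ 2 * (s * n) + 12 * n) : netExp (bTop s n) q = -2 := by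
  unfold bTop
  rw [netExp_bLin_of_ne (by omega), depL_upper (by norm_num : 1 ≤ 3) (by norm_num) (by omega) (by omega)]; norm_num

/-- `((2s+12)n, (2s+13)n]`: depth 2. -/
theorem ne_u2 (h : 2 * (s * n) + 12 * n < q ∧ q ≤ 2 * (s * n) + 13 * n) : netExp (bTop s n) q = -1 := by
  unfold bTop
  rw [netExp_bLin_of_ne (by omega), depL_upper (by norm_num : 1 ≤ 2) (by norm_num) (by omega) (by omega)]; norm_num

/-- `((2s+13)n, (2s+14)n]`: depth 1. -/
theorem ne_u1 (h : 2 * (s * n) + 13 * n < q ∧ q ≤ 2 * (s * n) + 14 * n) : netExp (bTop s n) q = 0 := by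
  unfold bTop
  rw [netExp_bLin_of_ne (by omega), depL_upper (by norm_num : 1 ≤ 1) (by norm_num) (by omega) (by omega)]; norm_num

/-- Above the blocks: `q > (2s+14)n`. -/
theorem ne_high (h : 2 * (s * n) + 14 * n < q) : netExp (bTop s n) q = 1 := by
  unfold bTop; rw [netExp_bLin_of_ne (by omega), depL_high (by omega)]; norm_num

variable {p x : ℕ} [Fact p.Prime]

/-- Typed class on the ray, not self-conjugate. -/
theorem topType_ne (L : ℕ) {T : List ℤ} (hlen : T.length = L + 1) (hx : x < p) (hL : x + L * p ≤ 3 * (s * n) + 16 * n)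
    (hL' : 3 * (s * n) + 16 * n < x + L * p + p) (hlev : Levels (bTop s n) x p T)
    (hne : 2 * x + L * p ≠ 3 * (s * n) + 16 * n) : IsType (bTop s n) p x T false :=
  isType_of_ne (by rw [bTop_zero]; positivity) L hlen hx (by rw [bTop_zero_toNat]; exact hL)
    (by rw [bTop_zero_toNat]; exact hL') hlev (by rw [bTop_zero_toNat]; exact hne)

/-- Typed class on the ray, self-conjugate. -/
theorem topType_eq (L : ℕ) {T : List ℤ} (hlen : T.length = L + 1) (hx : x < p) (hL : x + L * p ≤ 3 * (s * n) + 16 * n)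
    (hL' : 3 * (s * n) + 16 * n < x + L * p + p) (hlev : Levels (bTop s n) x p T)
    (heq : 2 * x + L * p = 3 * (s * n) + 16 * n) : IsType (bTop s n) p x T true :=
  isType_of_eq (by rw [bTop_zero]; positivity) L hlen hx (by rw [bTop_zero_toNat]; exact hL)
    (by rw [bTop_zero_toNat]; exact hL') hlev (by rw [bTop_zero_toNat]; exact heq)

end Levels

end Summit.KontsevichZagierPeriods.Zeta5Search.StairTop
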